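import Summits.BirchSwinnertonDyer.BirchSwinnertonDyer.Theorems.QuadraticBranchSignedControlPlusEtaNonsurjCartanFieldInert
import Summits.BirchSwinnertonDyer.BirchSwinnertonDyer.Theorems.QuadraticBranchSignedControlPlusEtaNonsurjCartanFieldImaginary
import HarnessLib

/-!
# Route `QuadraticBranchSignedControl` (rung K8, cell `bsd-potss`): crux stmt-BirchSwinnertonDyer-19606
# `PlusEtaMainConjectureNonsurj` — EVERY ROW CARRIES A `√ε`-STRUCTURE `(J, χ_V)`: `V[p]` is an `𝔽_{p²}`-line on which the
# Cartan subgroup acts LINEARLY (through a character) and its complement ANTI-linearly (kernel form of FINDING-g5 §2 (e), first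
# sentence, and of the input shape of FINDING-g9 §1 — the structure behind the CM-NEWFORM anchors of FINDING-g10)

WHAT. On a row of crux 19606 (`V/ℚ` globally minimal, `p ≥ 5` good, `a_p = 0`, `p`-adic tower NOT onto) the image of `ρ̄_{V,p}`
is exactly `C_ns⁺(ε)` in some frame `e` of `V[p]` (`ε` a non-square). k8eta-c2 g9 made the Cartan subgroup `H_V = ρ̄⁻¹(C_ns)`
intrinsic ("centralises the squares"), and ASSUMED, for CM anchors `A`, a displayed `√D`-structure `(Ψ ≠ 0, χ ≠ 1,
Ψ(σP) = χ(σ)·σΨ(P))`. This file PROVES that every row `V` ITSELF carries such a structure, canonically: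

* §1 matrix algebra of `S = (0, ε; 1, 0)` (`S² = ε`, `C_ns(ε) = 𝔽_p + 𝔽_p S`, the second coset anti-commutes with `S`).
* §2 in a frame: the endomorphism `J = e⁻¹ S e` of `V[p]` satisfies `J² = ε`, `J ≠ 0`; a `σ` whose matrix lies in `C_ns(ε)`
  COMMUTES with `J` and acts as `a + bJ` (`𝔽_p[J] ≅ 𝔽_{p²}`-LINEARLY: through the character `φ_V : H_V → 𝔽_p[J]ˣ`); a `σ` of
  the other coset ANTI-commutes with `J` (acts `𝔽_{p²}`-semilinearly).
* §3 the quadratic character `χ_V : Γ_ℚ →* ℤˣ` with `ker χ_V = H_V` (`exists_quadraticChar_centralizes_sq`).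
* §4 **`exists_sqrt_structure[_of_row]`**: `∃ χ J`, `χ ≠ 1`, `J ≠ 0`, `J(σP) = χ(σ)·σ·J(P)` for all `σ, P`,
  `χ σ = 1 ⟺ σ ∈ H_V`, `σ ∈ H_V ⟹ σ = a + bJ` on `V[p]`, `J² = n` with `n` a non-square mod `p` — i.e. `V[p]` is an
  `𝔽_{p²}`-line, `ρ̄_V|_{H_V}` is a CHARACTER `φ_V` with values in `𝔽_{p²}ˣ`, and `ρ̄_V ⊗ 𝔽_{p²} ≅ Ind_{K_V}^ℚ φ_V`. With
  `…CartanFieldInert` / `…CartanFieldImaginary`: `quadraticChar_local_of_row` — `χ_V` kills the inertia above `p` and above the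
  good and multiplicative places, takes the value `−1` on some element of every decomposition group above `p` and on every
  involution inverting `μ_p` (complex conjugation): **`χ_V` is the character of an imaginary quadratic field `K_V`, unramified
  outside `N_add(V)`, in which `p` is inert** — exactly the data `(K, type (1,0), unramified at p)` of a Hecke character whose
  CM newform `θ_ψ` anchors the row (FINDING-19606-k8eta-c2-g10: explicit for g5's anchorless rows; `ψ ≡ φ_V`).

HONEST FRAMING (cell `bsd-potss`, run/shared/lean/pub/bsd-potss/; FULL-BSD rank ≤ 1 programme): TOOL THEOREMS ONLY (no definition,
no named fact, no `sorry`, axioms standard). Nothing is booked; crux 19606 stays OPEN; `BSD(W, p)` is claimed for no pair. The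
existence of the Hecke character `ψ` lifting `φ_V` (class field theory + Teichmüller) and of `θ_ψ` (Hecke–Shimura–Ribet) is NOT
formalised here. Seat `bsd-potss-k8eta-c2` g10 (prover), `--supports stmt-BirchSwinnertonDyer-19606`.

References: [Serre1972] §2.1–2.2; [Ribet1977Nebentypus] §3; [Lang1987] Ch. 10 §4; [Zywina2015] Thm. 1.4.
-/

set_option autoImplicit false
set_option linter.dupNamespace false

noncomputable section

open scoped Classical NumberField Pointwise

open Matrix Field IsDedekindDomain NumberField WeierstrassCurve Literature.NumberTheory.EllipticCurves
  Literature.NumberTheory.SerreUniformity Literature.NumberTheory.EllipticCurves.Rank1Residual Rat.HeightOneSpectrum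

namespace Summit.BirchSwinnertonDyer.BirchSwinnertonDyer.Theorems.EtaCartanField

variable {p : ℕ} [hp : Fact p.Prime]

/-! ## §1 Matrix algebra of `S = (0, ε; 1, 0)` -/

omit hp in
/-- Two `2 × 2` matrix literals with equal entries are equal. [folklore] -/
private theorem mat_eq₂ {a b c d a' b' c' d' : ZMod p} (h₁ : a = a') (h₂ : b = b') (h₃ : c = c')
    (h₄ : d = d') :
    (!![a, b; c, d] : Matrix (Fin 2) (Fin 2) (ZMod p)) = !![a', b'; c', d'] := by
  subst h₁ h₂ h₃ h₄; rfl

/-- `S² = ε`: the matrix `S = (0, ε; 1, 0)` of `C_ns(ε)` is a square root of the scalar `ε`. [cite: Serre1972, §2.1] -/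
theorem sqrtShape_mul_self (ε : ZMod p) :
    (!![0, ε; 1, 0] * !![0, ε; 1, 0] : Matrix (Fin 2) (Fin 2) (ZMod p)) = ε • (1 : Matrix (Fin 2) (Fin 2) (ZMod p)) := by
  rw [Matrix.mul_fin_two, Matrix.smul_one_eq_diagonal]
  ext i j
  fin_cases i <;> fin_cases j <;> simp

/-- `C_ns(ε) = 𝔽_p + 𝔽_p S`: the Cartan shape `(a, εb; b, a)` is `a·1 + b·S`. [cite: Serre1972, §2.1] -/
theorem cartanShape_eq_smul_one_add_smul_sqrtShape (ε a b : ZMod p) :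
    (!![a, ε * b; b, a] : Matrix (Fin 2) (Fin 2) (ZMod p)) =
      a • (1 : Matrix (Fin 2) (Fin 2) (ZMod p)) + b • !![0, ε; 1, 0] := by
  rw [Matrix.smul_one_eq_diagonal]
  ext i j
  fin_cases i <;> fin_cases j <;> simp [mul_comm]

/-- The Cartan shape commutes with `S`. [cite: Serre1972, §2.1] -/
theorem cartanShape_mul_sqrtShape (ε a b : ZMod p) :
    (!![a, ε * b; b, a] * !![0, ε; 1, 0] : Matrix (Fin 2) (Fin 2) (ZMod p)) = !![0, ε; 1, 0] * !![a, ε * b; b, a] := by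
  rw [Matrix.mul_fin_two, Matrix.mul_fin_two]
  exact mat_eq₂ (by ring) (by ring) (by ring) (by ring)

/-- **Frobenius**: the second coset `(c, −εd; d, −c)` ANTI-commutes with `S`. [cite: Serre1972, §2.2] -/
theorem cosetShape_mul_sqrtShape (ε c d : ZMod p) :
    (!![c, -(ε * d); d, -c] * !![0, ε; 1, 0] : Matrix (Fin 2) (Fin 2) (ZMod p)) = -(!![0, ε; 1, 0] * !![c, -(ε * d); d, -c]) := by
  rw [Matrix.mul_fin_two, Matrix.mul_fin_two, Matrix.neg_of]
  simp only [Matrix.neg_cons, Matrix.neg_empty]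
  exact mat_eq₂ (by ring) (by ring) (by ring) (by ring)

/-! ## §2 In a frame: the endomorphism `J = e⁻¹ S e` of `V[p]` -/

section Frame

variable {V : WeierstrassCurve ℚ} (e : V.geomTorsion p ≃+ (Fin 2 → ZMod p)) {ε : ZMod p}

/-- `ℤ`-multiples on `V[p]` read through the frame: `e (n • P) = (n : 𝔽_p) • e P`. [folklore] -/
theorem frame_zsmul (n : ℤ) (P : V.geomTorsion p) : e (n • P) = (n : ZMod p) • e P := by
  rw [map_zsmul, Int.cast_smul_eq_zsmul]

/-- **`J² = ε`** for `J = e⁻¹ S e`. [cite: Serre1972, §2.1] -/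
theorem sqrt_comp_sqrt (J : AddMonoid.End (V.geomTorsion p)) (hJ : ∀ P : V.geomTorsion p, e (J P) = !![0, ε; 1, 0] *ᵥ e P)
    (P : V.geomTorsion p) : J (J P) = ((ε.val : ℕ) : ℤ) • P := by
  apply e.injective
  rw [hJ, hJ, Matrix.mulVec_mulVec, sqrtShape_mul_self, Matrix.smul_mulVec, Matrix.one_mulVec, frame_zsmul,
    Int.cast_natCast, ZMod.natCast_zmod_val]

/-- **`J ≠ 0`** (`S` is invertible: `S² = ε ≠ 0`, and `V[p] ≠ 0`). [folklore] -/
theorem sqrt_ne_zero (hε : ¬ IsSquare ε) (J : AddMonoid.End (V.geomTorsion p))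
    (hJ : ∀ P : V.geomTorsion p, e (J P) = !![0, ε; 1, 0] *ᵥ e P) : J ≠ 0 := by
  have hε0 : ε ≠ 0 := fun h => hε ⟨0, by simp [h]⟩
  intro hJ0
  -- `P₀ = e⁻¹ (1, 0)`; `J (J P₀) = ε P₀ ≠ 0` but `J = 0`
  set P₀ : V.geomTorsion p := e.symm ![1, 0] with hP₀
  have h1 : J (J P₀) = 0 := by rw [hJ0]; rfl
  have h2 := sqrt_comp_sqrt e J hJ P₀
  rw [h1] at h2
  have h3 := congrArg e h2
  rw [map_zero, frame_zsmul, Int.cast_natCast, ZMod.natCast_zmod_val, hP₀, AddEquiv.apply_symm_apply] at h3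
  have h4 := congrFun h3 0
  simp only [Pi.zero_apply, Pi.smul_apply, Matrix.cons_val_zero, smul_eq_mul, mul_one] at h4
  exact hε0 h4.symm

/-- **Linearity on the Cartan subgroup**: if the matrix of `σ` is the Cartan shape `(a, εb; b, a)`, then `σ` acts on `V[p]` as
`a + bJ` — `𝔽_p[J]`-linearly, through the "character value" `a + b√ε ∈ 𝔽_{p²}ˣ`. [cite: Serre1972, §2.1] -/
theorem smul_eq_of_cartanShape (J : AddMonoid.End (V.geomTorsion p))
    (hJ : ∀ P : V.geomTorsion p, e (J P) = !![0, ε; 1, 0] *ᵥ e P) {σ : absoluteGaloisGroup ℚ} {a b : ZMod p}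
    (hσ : ∀ P : V.geomTorsion p, e (σ • P) = !![a, ε * b; b, a] *ᵥ e P) (P : V.geomTorsion p) :
    σ • P = ((a.val : ℕ) : ℤ) • P + ((b.val : ℕ) : ℤ) • J P := by
  apply e.injective
  rw [hσ, map_add, frame_zsmul, frame_zsmul, hJ, Int.cast_natCast, Int.cast_natCast, ZMod.natCast_zmod_val,
    ZMod.natCast_zmod_val, cartanShape_eq_smul_one_add_smul_sqrtShape, Matrix.add_mulVec, Matrix.smul_mulVec,
    Matrix.smul_mulVec, Matrix.one_mulVec]

/-- **`J` commutes with the Cartan subgroup**: if the matrix of `σ` lies in `C_ns(ε)` then `J(σP) = σ J(P)`. [cite: Serre1972, §2.1] -/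
theorem sqrt_smul_of_mem_nonsplitCartan (J : AddMonoid.End (V.geomTorsion p))
    (hJ : ∀ P : V.geomTorsion p, e (J P) = !![0, ε; 1, 0] *ᵥ e P) {σ : absoluteGaloisGroup ℚ}
    {M : Matrix (Fin 2) (Fin 2) (ZMod p)} (hM : M ∈ nonsplitCartan ε)
    (hσ : ∀ P : V.geomTorsion p, e (σ • P) = M *ᵥ e P) (P : V.geomTorsion p) : J (σ • P) = σ • J P := by
  obtain ⟨a, b, -, rfl⟩ := hM
  apply e.injective
  rw [hJ, hσ, hσ, hJ, Matrix.mulVec_mulVec, Matrix.mulVec_mulVec, cartanShape_mul_sqrtShape]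

/-- **`J` anti-commutes with the other coset**: if the matrix of `σ` lies in `C_ns⁺(ε) ∖ C_ns(ε)` then `J(σP) = −σ J(P)` —
`σ` acts `𝔽_{p²}`-SEMI-linearly (Frobenius). [cite: Serre1972, §2.2] -/
theorem sqrt_smul_of_not_mem_nonsplitCartan (J : AddMonoid.End (V.geomTorsion p))
    (hJ : ∀ P : V.geomTorsion p, e (J P) = !![0, ε; 1, 0] *ᵥ e P) {σ : absoluteGaloisGroup ℚ}
    {M : Matrix (Fin 2) (Fin 2) (ZMod p)} (hM : M ∈ nonsplitCartanNormalizer ε) (hM' : M ∉ nonsplitCartan ε)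
    (hσ : ∀ P : V.geomTorsion p, e (σ • P) = M *ᵥ e P) (P : V.geomTorsion p) : J (σ • P) = -(σ • J P) := by
  obtain ⟨c, d, -, rfl⟩ := exists_eq_coset_of_not_mem_nonsplitCartan hM hM'
  apply e.injective
  rw [map_neg, hJ, hσ, hσ, hJ, Matrix.mulVec_mulVec, Matrix.mulVec_mulVec, cosetShape_mul_sqrtShape, Matrix.neg_mulVec,
    neg_neg]

end Frame

/-! ## §3 The quadratic character `χ_V` of the Cartan subgroup -/

/-- **The quadratic character `χ_V : Γ_ℚ → {±1}` with kernel the Cartan subgroup** (`Im ρ̄_{V,p} = C_ns⁺(p)`, `p ≠ 2`):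
`χ_V(σ) = 1 ⟺ σ` centralises the squares on `V[p]`, and `χ_V ≠ 1`. Its kernel's fixed field is the Cartan field `K_V`
(`= ε_V : Γ_ℚ → N/C` of FINDING-g5 §2 (b)). No definition is introduced (an ∃-statement). [cite: Serre1972, §2.2, §4.2 c)] -/
theorem exists_quadraticChar_centralizes_sq {V : WeierstrassCurve ℚ} (hp2 : p ≠ 2)
    (h : HasModPImageEqNonsplitCartanNormalizer V p) :
    ∃ χ : absoluteGaloisGroup ℚ →* ℤˣ, (∃ σ : absoluteGaloisGroup ℚ, χ σ ≠ 1) ∧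
      ∀ σ : absoluteGaloisGroup ℚ, χ σ = 1 ↔
        ∀ (τ : absoluteGaloisGroup ℚ) (P : V.geomTorsion p), σ • ((τ * τ) • P) = (τ * τ) • (σ • P) := by
  obtain ⟨H, hH2, hHmem⟩ := exists_subgroup_index_two_centralizes_sq hp2 h
  let f : absoluteGaloisGroup ℚ → ℤˣ := fun σ => if σ ∈ H then 1 else -1
  have hf : ∀ σ, f σ = if σ ∈ H then 1 else -1 := fun _ => rfl
  have hmul : ∀ a b : absoluteGaloisGroup ℚ, f (a * b) = f a * f b := by
    intro a b
    have hab := Subgroup.mul_mem_iff_of_index_two hH2 (a := a) (b := b)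
    rw [hf, hf, hf]
    by_cases ha : a ∈ H <;> by_cases hb : b ∈ H
    · rw [if_pos (hab.mpr (iff_of_true ha hb)), if_pos ha, if_pos hb, one_mul]
    · rw [if_neg (fun h => hb ((hab.mp h).mp ha)), if_pos ha, if_neg hb, one_mul]
    · rw [if_neg (fun h => ha ((hab.mp h).mpr hb)), if_neg ha, if_pos hb, mul_one]
    · rw [if_pos (hab.mpr (iff_of_false ha hb)), if_neg ha, if_neg hb]
      decide
  let χ : absoluteGaloisGroup ℚ →* ℤˣ :=
    { toFun := f
      map_one' := by rw [hf, if_pos H.one_mem]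
      map_mul' := hmul }
  have hχ : ∀ σ, χ σ = f σ := fun _ => rfl
  have hne : (-1 : ℤˣ) ≠ 1 := by decide
  refine ⟨χ, ?_, fun σ => ?_⟩
  · obtain ⟨σ₀, hσ₀⟩ := exists_not_centralizes_sq hp2 h
    refine ⟨σ₀, fun h1 => hσ₀ ((hHmem σ₀).mp ?_)⟩
    rw [hχ, hf] at h1
    by_contra hmem
    rw [if_neg hmem] at h1
    exact hne h1
  · rw [← hHmem σ, hχ, hf]
    constructor
    · intro h1
      by_contra hmem
      rw [if_neg hmem] at h1
      exact hne h1
    · intro hmem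
      rw [if_pos hmem]

/-! ## §4 The `√ε`-structure of a row -/

/-- **Every curve with image `C_ns⁺(p)` carries a `√ε`-structure `(J, χ_V)`** — the displayed CM-anchor input shape of
`…CartanFieldCMAnchor` (`Ψ ≠ 0`, `χ ≠ 1`, `Ψ(σP) = χ(σ)·σΨ(P)`), PROVED for `V` itself with `χ = χ_V` the character of the
Cartan field: there are `χ : Γ_ℚ →* ℤˣ` and `J ∈ End(V[p])` with (i) `χ ≠ 1`, (ii) `J ≠ 0`, (iii) `J(σP) = χ(σ)·σ·J(P)`,
(iv) `χ(σ) = 1 ⟺ σ ∈ H_V` (centralises the squares), (v) every `σ ∈ H_V` acts as `a + bJ` (`a, b ∈ ℤ`, i.e. `∈ 𝔽_p`):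
`ρ̄_V|_{H_V}` is a CHARACTER `φ_V : H_V → 𝔽_p[J]ˣ ≅ 𝔽_{p²}ˣ`, and (vi) `J² = n` with `n mod p` a non-square — `V[p]` is an
`𝔽_{p²}`-LINE, `ρ̄_V ⊗ 𝔽_{p²} ≅ Ind_{K_V}^{ℚ} φ_V`. [cite: Serre1972, §2.1–2.2] [cite: Lang1987, Ch. 10 §4] -/
theorem exists_sqrt_structure {V : WeierstrassCurve ℚ} (hp2 : p ≠ 2) (h : HasModPImageEqNonsplitCartanNormalizer V p) :
    ∃ (χ : absoluteGaloisGroup ℚ →* ℤˣ) (J : AddMonoid.End (V.geomTorsion p)),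
      (∃ σ : absoluteGaloisGroup ℚ, χ σ ≠ 1) ∧ J ≠ 0 ∧
      (∀ (σ : absoluteGaloisGroup ℚ) (P : V.geomTorsion p), J (σ • P) = ((χ σ : ℤˣ) : ℤ) • σ • J P) ∧
      (∀ σ : absoluteGaloisGroup ℚ, χ σ = 1 ↔
        ∀ (τ : absoluteGaloisGroup ℚ) (P : V.geomTorsion p), σ • ((τ * τ) • P) = (τ * τ) • (σ • P)) ∧
      (∀ σ : absoluteGaloisGroup ℚ, χ σ = 1 → ∃ a b : ℤ, ∀ P : V.geomTorsion p, σ • P = a • P + b • J P) ∧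
      (∃ n : ℤ, ¬ IsSquare ((n : ℤ) : ZMod p) ∧ ∀ P : V.geomTorsion p, J (J P) = n • P) := by
  obtain ⟨χ, hχne, hχiff⟩ := exists_quadraticChar_centralizes_sq hp2 h
  obtain ⟨e, ε, hε, himg, hsurj⟩ := h
  -- the endomorphism `J = e⁻¹ S e`
  let S : Matrix (Fin 2) (Fin 2) (ZMod p) := !![0, ε; 1, 0]
  let J : AddMonoid.End (V.geomTorsion p) :=
    e.symm.toAddMonoidHom.comp ((Matrix.mulVecLin S).toAddMonoidHom.comp e.toAddMonoidHom)
  have hJ : ∀ P : V.geomTorsion p, e (J P) = !![0, ε; 1, 0] *ᵥ e P := fun P => by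
    show e (e.symm (Matrix.mulVecLin S (e P))) = _
    rw [AddEquiv.apply_symm_apply, Matrix.mulVecLin_apply]
  -- `χ σ = 1` iff the matrix of `σ` lies in `C_ns(ε)`
  have hχC : ∀ (σ : absoluteGaloisGroup ℚ) (M : Matrix (Fin 2) (Fin 2) (ZMod p)), M ∈ nonsplitCartanNormalizer ε →
      (∀ P : V.geomTorsion p, e (σ • P) = M *ᵥ e P) → (χ σ = 1 ↔ M ∈ nonsplitCartan ε) := fun σ M hM hσ => by
    rw [hχiff σ, matrix_mem_nonsplitCartan_iff_centralizes_sq hp2 e hε himg hsurj hM hσ]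
  refine ⟨χ, J, hχne, sqrt_ne_zero e hε J hJ, fun σ P => ?_, hχiff, fun σ hσ1 => ?_,
    ⟨((ε.val : ℕ) : ℤ), ?_, sqrt_comp_sqrt e J hJ⟩⟩
  · -- equivariance `J(σP) = χ(σ) σ J(P)`
    obtain ⟨M, hM, hσ⟩ := himg σ
    by_cases hMC : M ∈ nonsplitCartan ε
    · rw [(hχC σ M hM hσ).mpr hMC, Units.val_one, one_smul]
      exact sqrt_smul_of_mem_nonsplitCartan e J hJ hMC hσ P
    · have hχσ : χ σ = -1 := by
        rcases Int.units_eq_one_or (χ σ) with h1 | h1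
        · exact absurd ((hχC σ M hM hσ).mp h1) hMC
        · exact h1
      rw [hχσ, Units.val_neg, Units.val_one, neg_smul, one_smul]
      exact sqrt_smul_of_not_mem_nonsplitCartan e J hJ hM hMC hσ P
  · -- linearity on `H_V`
    obtain ⟨M, hM, hσ⟩ := himg σ
    have hMC : M ∈ nonsplitCartan ε := (hχC σ M hM hσ).mp hσ1
    obtain ⟨a, b, -, rfl⟩ := hMC
    exact ⟨((a.val : ℕ) : ℤ), ((b.val : ℕ) : ℤ), smul_eq_of_cartanShape e J hJ hσ⟩
  · rw [Int.cast_natCast, ZMod.natCast_zmod_val]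
    exact hε

/-- **The `√ε`-structure on every row of crux 19606** (`V/ℚ` globally minimal, `p ≥ 5` good, `a_p = 0`, `p`-adic tower NOT
onto): the conclusion of `exists_sqrt_structure`. [cite: Serre1972, §2.1–2.2] [cite: Zywina2015, Thm. 1.4] -/
theorem exists_sqrt_structure_of_row (V : WeierstrassCurve ℚ) [V.IsElliptic] [V.IsGloballyMinimal] (p : ℕ) [Fact p.Prime]
    (hp5 : 5 ≤ p) (hgood : V.HasGoodReductionAtPrime p) (hap : V.frobeniusTrace p = 0)
    (hns : ¬ ∀ m : ℕ, V.HasSurjectiveModNGaloisRep (p ^ m : ℕ)) :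
    ∃ (χ : absoluteGaloisGroup ℚ →* ℤˣ) (J : AddMonoid.End (V.geomTorsion p)),
      (∃ σ : absoluteGaloisGroup ℚ, χ σ ≠ 1) ∧ J ≠ 0 ∧
      (∀ (σ : absoluteGaloisGroup ℚ) (P : V.geomTorsion p), J (σ • P) = ((χ σ : ℤˣ) : ℤ) • σ • J P) ∧
      (∀ σ : absoluteGaloisGroup ℚ, χ σ = 1 ↔
        ∀ (τ : absoluteGaloisGroup ℚ) (P : V.geomTorsion p), σ • ((τ * τ) • P) = (τ * τ) • (σ • P)) ∧
      (∀ σ : absoluteGaloisGroup ℚ, χ σ = 1 → ∃ a b : ℤ, ∀ P : V.geomTorsion p, σ • P = a • P + b • J P) ∧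
      (∃ n : ℤ, ¬ IsSquare ((n : ℤ) : ZMod p) ∧ ∀ P : V.geomTorsion p, J (J P) = n • P) :=
  exists_sqrt_structure (by omega) (hasModPImageEqNonsplitCartanNormalizer_of_row V p hp5 hgood hap hns)

/-- **The quadratic character `χ_V` of a row is ODD, UNRAMIFIED at `p` and outside the additive primes, and `χ_V(Frob_p) = −1`.**
On every row of crux 19606 there is `χ : Γ_ℚ →* ℤˣ` with: `χ ≠ 1`; `χ(σ) = 1 ⟺ σ ∈ H_V`; `χ` kills the inertia group of every
prime of `ℤ̄` above `p`, above every good place and above every multiplicative place of `V` (`inertia_centralizes_sq_of_row`);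
above every prime `𝔓 ∣ p` some `φ ∈ Stab(𝔓)` has `χ(φ) = −1` (`forall_exists_frob_not_centralizes_sq_of_row`); and every
involution `σ` of `V[p]` inverting the `p`-th roots of unity (complex conjugation) has `χ(σ) = −1`
(`not_centralizes_sq_of_inverts_rootsOfUnity_of_row`). In words: `χ_V = χ_{K_V}` for an IMAGINARY quadratic field `K_V`,
unramified outside `N_add(V)`, in which `p` is INERT — with `exists_sqrt_structure_of_row`, `ρ̄_{V,p} ⊗ 𝔽_{p²} = Ind_{K_V} φ_V`
is exactly the residual shape of the `𝔓`-adic representation of a weight-`2` CM newform `θ_ψ` of `K_V` with `ψ` of type `(1,0)`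
unramified at `p` (FINDING-19606-k8eta-c2-g10). [cite: Serre1972, §1.11 Prop. 12 d), §2.2, §4.2 c)] [cite: Ribet1977Nebentypus, §3] -/
theorem quadraticChar_local_of_row (V : WeierstrassCurve ℚ) [V.IsElliptic] [V.IsGloballyMinimal] (p : ℕ) [Fact p.Prime]
    (hp5 : 5 ≤ p) (hgood : V.HasGoodReductionAtPrime p) (hap : V.frobeniusTrace p = 0)
    (hns : ¬ ∀ m : ℕ, V.HasSurjectiveModNGaloisRep (p ^ m : ℕ)) :
    ∃ χ : absoluteGaloisGroup ℚ →* ℤˣ, (∃ σ : absoluteGaloisGroup ℚ, χ σ ≠ 1) ∧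
      (∀ σ : absoluteGaloisGroup ℚ, χ σ = 1 ↔
        ∀ (τ : absoluteGaloisGroup ℚ) (P : V.geomTorsion p), σ • ((τ * τ) • P) = (τ * τ) • (σ • P)) ∧
      (∀ v : HeightOneSpectrum (𝓞 ℚ),
        ((p : 𝓞 ℚ) ∈ v.asIdeal ∨ V.HasGoodReductionAt v ∨ V.HasMultiplicativeReductionAt v) →
        ∀ 𝔔 ∈ v.primesAbove, ∀ σ ∈ 𝔔.inertia (absoluteGaloisGroup ℚ), χ σ = 1) ∧
      (∀ v : HeightOneSpectrum (𝓞 ℚ), (primesEquiv v : ℕ) = p →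
        ∀ 𝔓 ∈ v.primesAbove, ∃ φ ∈ MulAction.stabilizer (absoluteGaloisGroup ℚ) 𝔓, χ φ = -1) ∧
      (∀ σ : absoluteGaloisGroup ℚ, (∀ P : V.geomTorsion p, σ • (σ • P) = P) →
        (∀ t : AlgebraicClosure ℚ, t ^ p = 1 → σ • t = t⁻¹) → χ σ = -1) := by
  obtain ⟨χ, hχne, hχiff⟩ := exists_quadraticChar_centralizes_sq (by omega)
    (hasModPImageEqNonsplitCartanNormalizer_of_row V p hp5 hgood hap hns)
  have hneg : ∀ σ, χ σ ≠ 1 → χ σ = -1 := fun σ hσ => (Int.units_eq_one_or (χ σ)).resolve_left hσ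
  refine ⟨χ, hχne, hχiff, fun v hv 𝔔 h𝔔 σ hσ => ?_, fun v hv 𝔓 h𝔓 => ?_, fun σ hσσ hinv => ?_⟩
  · exact (hχiff σ).mpr (inertia_centralizes_sq_of_row V p hp5 hgood hap hns hv h𝔔 hσ)
  · obtain ⟨φ, hφ, hnot⟩ := forall_exists_frob_not_centralizes_sq_of_row V p hp5 hgood hap hns hv h𝔓
    exact ⟨φ, hφ, hneg φ (fun h1 => hnot ((hχiff φ).mp h1))⟩
  · exact hneg σ (fun h1 =>
      not_centralizes_sq_of_inverts_rootsOfUnity_of_row V p hp5 hgood hap hns hσσ hinv ((hχiff σ).mp h1))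

end Summit.BirchSwinnertonDyer.BirchSwinnertonDyer.Theorems.EtaCartanField

end
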